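import Mathlib
import HarnessLib
import Summits.ValiantsHypothesis.ValiantsHypothesis.Theses.MonotoneRestoration
import Literature.Computability.AlgebraicComplexity.ArithCircuit
import Literature.Computability.AlgebraicComplexity.ArithCircuitProofs
import Literature.Computability.AlgebraicComplexity.MonotoneStructure
import Literature.Computability.AlgebraicComplexity.PermanentIrreducible
import Literature.ModelTheory.FiniteModelTheory.CkEquiv
import Summits.ValiantsHypothesis.ValiantsHypothesis.Theorems.MonotoneRestorationMonotoneRestorationQPCosetCount
import Summits.ValiantsHypothesis.ValiantsHypothesis.Theorems.MonotoneRestorationMonotoneRestorationQPSymmetricLB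
import Summits.ValiantsHypothesis.ValiantsHypothesis.Theorems.MonotoneRestorationMonotoneRestorationQPSupportSymmetrisation
import Summits.ValiantsHypothesis.ValiantsHypothesis.Theorems.MonotoneRestorationMonotoneRestorationQPSparseRegime
import Summits.ValiantsHypothesis.ValiantsHypothesis.Theorems.MonotoneRestorationMonotoneRestorationQPBeta
import Literature.Computability.AlgebraicComplexity.SymmetricArithCircuit
import Literature.Computability.AlgebraicComplexity.DawarWilsenach2025Proofs
import Literature.GroupTheory.PermutationGroups.SmallIndexSubgroups
import Summits.ValiantsHypothesis.ValiantsHypothesis.Theorems.MonotoneRestorationQP.Negative.LoadBearing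
import Summits.ValiantsHypothesis.ValiantsHypothesis.Theorems.MonotoneRestorationMonotoneRestorationQPPermSupportCount

/-! # TTRL-lite variant V18921 of `MonotoneRestorationQP` / `stub_mulGate_children_extend` (stmt-ValiantsHypothesis-15886)

Machine-generated helper (proved); move `lemma_proposal`, op `llm`: a nonzero finite product of
polynomials has nonzero factors (contrapositive of `Finset.prod_eq_zero`); with `eval_of_label_mul`
this gives `C.eval h ≠ 0` for every child `h` of a nonzero product gate.
See docs/architecture/ttrl-lite.md. -/

set_option linter.dupNamespace false

namespace Summit.ValiantsHypothesis.ValiantsHypothesis.Theorems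

open Summit.ValiantsHypothesis.ValiantsHypothesis.Theses.MonotoneRestoration
open Literature.Computability.AlgebraicComplexity

/-- TTRL-lite variant V18921 (lemma_proposal `llm`) of `stub_mulGate_children_extend`
(stmt-ValiantsHypothesis-15886): if a finite product `∏ a ∈ s, p a` of polynomials is nonzero then
every factor `p a`, `a ∈ s`, is nonzero (contrapositive of `Finset.prod_eq_zero`); machine-found,
kernel-checked. -/
theorem stub_mulGate_children_extend_var18921 :
    ∀ (n : ℕ) (α : Type) (s : Finset α) (p : α → MvPolynomial (Fin n × Fin n) NNReal),
      (∏ a ∈ s, p a) ≠ 0 → ∀ a ∈ s, p a ≠ 0 :=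
  fun _n _α _s _p h _a ha hpa => h (Finset.prod_eq_zero ha hpa)

end Summit.ValiantsHypothesis.ValiantsHypothesis.Theorems
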